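import Mathlib.Analysis.Matrix.Order
import Mathlib.Analysis.Matrix.Spectrum
import Mathlib.Analysis.Matrix.PosDef
import Literature.LinearAlgebra.Matrix.HermitianCfcDiagonalForm
import Literature.LinearAlgebra.Matrix.FiniteRangeDecompositionMatrix
import HarnessLib

/-!
# The determinant under a subcritical positive semidefinite defect of rank `≤ k`:
# `ε^k · det Q ≤ det (Q − D)`

Topic `LinearAlgebra/Matrix`, namespace `Literature.LinearAlgebra.Matrix`.  For a real positive
definite `Q`, a positive semidefinite `D` of rank at most `k` with `D ⪯ (1 − ε)Q` (`0 < ε ≤ 1`):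

  `ε^k · det Q ≤ det (Q − D)`.

Proof: whiten by `T = Q^{-1/2}` (functional calculus, `T Q T = 1`), so that
`det(Q − D) = det Q · det(1 − P)` with `P = T D T`, `0 ⪯ P ⪯ (1−ε)·1`, `rank P ≤ k`; by the spectral
theorem `det(1 − P) = Π_i (1 − p_i)` over the eigenvalues `p_i ∈ [0, 1−ε]` of `P`, of which at
most `rank P ≤ k` are nonzero, whence `det(1 − P) ≥ ε^k`.  This is the Gaussian cost of a
low-rank "defect" in a quadratic form (ratio of Gaussian normalisations
`(det(Q−D)/det Q)^{1/2} ≥ ε^{k/2}`), the linear-algebra lemma behind large-field/defect estimates in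
which a positive form is lowered on a set of `k` modes (Horn–Johnson, *Matrix Analysis*, Cor. 4.3.12 /
Thm. 4.3.1 (Weyl) give the eigenvalue facts; the determinant form is [folklore]).

## Contents (no definitions)

* `det_unitary_conj`, `det_cfc_eq_prod` — `det f(A) = Π_k f(μ_k)` from any unitary diagonalisation;
* `exists_whitening` — `Q ≻ 0 ⟹ ∃ T = Tᴴ, T Q T = 1`;
* `det_one_sub_ge_pow` — `0 ⪯ P ⪯ (1−ε)1`, `rank P ≤ k` ⟹ `ε^k ≤ det(1 − P)`;
* **`pow_mul_det_le_det_sub`** — the displayed inequality.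
-/

noncomputable section

open Matrix Finset
open scoped MatrixOrder ComplexOrder

namespace Literature.LinearAlgebra.Matrix

variable {𝕜 : Type*} [RCLike 𝕜] {ι : Type*} [Fintype ι] [DecidableEq ι]

/-! ### Determinant of a matrix function -/

/-- Unitary conjugation preserves the determinant. [folklore] -/
theorem det_unitary_conj {V : Matrix ι ι 𝕜} (hV : V ∈ Matrix.unitaryGroup ι 𝕜) (M : Matrix ι ι 𝕜) :
    det (V * M * star V) = det M := by
  have h1 : V * star V = 1 := Matrix.mem_unitaryGroup_iff.mp hV
  rw [det_mul, det_mul, mul_comm (det V), mul_assoc, ← det_mul, h1, det_one, mul_one]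

/-- **`det f(A) = Π_k f(μ_k)`** for a Hermitian matrix diagonalised by a unitary `V` with diagonal
`μ`. [folklore] -/
theorem det_cfc_eq_prod {A V : Matrix ι ι 𝕜} (hV : V ∈ Matrix.unitaryGroup ι 𝕜)
    {μ : ι → ℝ} (hAV : A = V * diagonal (fun k => ((μ k : ℝ) : 𝕜)) * star V) (f : ℝ → ℝ) :
    det (cfc f A) = ((∏ k, f (μ k) : ℝ) : 𝕜) := by
  rw [cfc_eq_conj_diagonal hV hAV f, det_unitary_conj hV, det_diagonal]
  push_cast
  rfl

/-- `det f(A) = Π_k f(λ_k)` over Mathlib's eigenvalues. [folklore] -/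
theorem det_cfc_eq_prod_eigenvalues {A : Matrix ι ι 𝕜} (hA : A.IsHermitian) (f : ℝ → ℝ) :
    det (cfc f A) = ((∏ k, f (hA.eigenvalues k) : ℝ) : 𝕜) :=
  det_cfc_eq_prod hA.eigenvectorUnitary.2 hA.spectral_theorem f

/-! ### Whitening a positive definite matrix -/

/-- **Whitening**: a positive definite real matrix `Q` admits a symmetric `T` (namely `Q^{-1/2}`)
with `T Q T = 1`. [folklore] -/
theorem exists_whitening {Q : Matrix ι ι ℝ} (hQ : Q.PosDef) :
    ∃ T : Matrix ι ι ℝ, T.IsHermitian ∧ T * Q * T = 1 := by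
  have hQsa : IsSelfAdjoint Q := hQ.1
  have hpos : ∀ x ∈ spectrum ℝ Q, 0 < x := by
    intro x hx
    rw [hQ.1.spectrum_real_eq_range_eigenvalues] at hx
    obtain ⟨i, rfl⟩ := hx
    exact hQ.eigenvalues_pos i
  set g : ℝ → ℝ := fun x => (Real.sqrt x)⁻¹ with hg
  refine ⟨cfc g Q, ?_, ?_⟩
  · have : IsSelfAdjoint (cfc g Q) := cfc_predicate g Q
    exact this
  · have hid : cfc (fun x : ℝ => x) Q = Q := cfc_id' ℝ Q
    have hcongr : cfc (fun x => g x * x * g x) Q = cfc (fun _ : ℝ => (1 : ℝ)) Q := by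
      refine cfc_congr fun x hx => ?_
      have hx0 : 0 < x := hpos x hx
      have hs : 0 < Real.sqrt x := Real.sqrt_pos.mpr hx0
      simp only [hg]
      field_simp
      rw [Real.sq_sqrt hx0.le]
    calc cfc g Q * Q * cfc g Q = cfc g Q * cfc (fun x : ℝ => x) Q * cfc g Q := by rw [hid]
      _ = cfc (fun x => g x * x * g x) Q := by
          rw [← cfc_mul g (fun x : ℝ => x) Q (cfc_continuousOn Q g) (cfc_continuousOn Q _),
            ← cfc_mul _ g Q (cfc_continuousOn Q _) (cfc_continuousOn Q g)]
      _ = cfc (fun _ : ℝ => (1 : ℝ)) Q := hcongr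
      _ = 1 := cfc_const_one ℝ Q

/-! ### The whitened inequality -/

/-- **`0 ⪯ P ⪯ (1−ε)·1` and `rank P ≤ k` imply `ε^k ≤ det(1 − P)`** (`0 < ε ≤ 1`): the eigenvalues
of `P` lie in `[0, 1−ε]` and at most `k` of them are nonzero. [cite: HornJohnson2013, Thm. 4.1.5 & Cor. 4.3.12 (spectral theorem; eigenvalue monotonicity)] -/
theorem det_one_sub_ge_pow {P : Matrix ι ι ℝ} (hP : P.PosSemidef) {ε : ℝ} {k : ℕ} (hε : 0 < ε)
    (hε1 : ε ≤ 1) (hle : ((1 - ε) • (1 : Matrix ι ι ℝ) - P).PosSemidef) (hrank : P.rank ≤ k) :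
    ε ^ k ≤ (1 - P).det := by
  have hH : P.IsHermitian := hP.1
  set p : ι → ℝ := hH.eigenvalues with hp
  have hp0 : ∀ i, 0 ≤ p i := fun i => hP.eigenvalues_nonneg i
  have hp1 : ∀ i, p i ≤ 1 - ε := fun i =>
    MatrixFRD.spectrum_le_of_posSemidef_sub hH hle _ (hH.eigenvalues_mem_spectrum_real i)
  -- `det (1 - P) = ∏ (1 - p i)`
  have hdet : (1 - P).det = ∏ i, (1 - p i) := by
    have hcfc : cfc (fun x : ℝ => 1 - x) P = 1 - P := by
      have hP' : IsSelfAdjoint P := hH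
      rw [cfc_sub (fun _ : ℝ => (1 : ℝ)) (fun x : ℝ => x) P (cfc_continuousOn P _) (cfc_continuousOn P _),
        cfc_const_one ℝ P, cfc_id' ℝ P]
    rw [← hcfc, det_cfc_eq_prod_eigenvalues hH]
    rfl
  rw [hdet]
  -- at most `k` eigenvalues are nonzero
  have hcard : (univ.filter fun i => p i ≠ 0).card ≤ k := by
    have h := hH.rank_eq_card_non_zero_eigs
    rw [Fintype.card_subtype] at h
    rw [← h]
    exact hrank
  calc ε ^ k ≤ ε ^ (univ.filter fun i => p i ≠ 0).card := pow_le_pow_of_le_one hε.le hε1 hcard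
    _ = ∏ i, (if p i ≠ 0 then ε else 1) := by
        rw [prod_ite, prod_const_one, mul_one, prod_const]
    _ ≤ ∏ i, (1 - p i) := by
        refine prod_le_prod (fun i _ => by split_ifs <;> linarith) fun i _ => ?_
        split_ifs with h
        · linarith [hp1 i]
        · have : p i = 0 := not_not.mp h
          rw [this, sub_zero]

/-! ### The inequality -/

/-- **The determinant under a subcritical low-rank positive semidefinite defect.**  For real
matrices, `Q ≻ 0`, `D ⪰ 0`, `(1 − ε)Q − D ⪰ 0` with `0 < ε ≤ 1` and `rank D ≤ k`:
`ε^k · det Q ≤ det(Q − D)`. [folklore] -/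
theorem pow_mul_det_le_det_sub (Q D : Matrix ι ι ℝ) (ε : ℝ) (k : ℕ) (hε : 0 < ε) (hε1 : ε ≤ 1)
    (hQ : Q.PosDef) (hD : D.PosSemidef) (hsub : ((1 - ε) • Q - D).PosSemidef) (hk : D.rank ≤ k) :
    ε ^ k * Q.det ≤ (Q - D).det := by
  obtain ⟨T, hT, hTQT⟩ := exists_whitening hQ
  have hTH : Tᴴ = T := hT
  -- the whitened defect
  set P : Matrix ι ι ℝ := T * D * T with hPdef
  have hP : P.PosSemidef := by
    have := hD.conjTranspose_mul_mul_same T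
    rwa [hTH] at this
  have hPle : ((1 - ε) • (1 : Matrix ι ι ℝ) - P).PosSemidef := by
    have h := hsub.conjTranspose_mul_mul_same T
    rw [hTH] at h
    have hcalc : T * ((1 - ε) • Q - D) * T = (1 - ε) • (1 : Matrix ι ι ℝ) - P := by
      rw [Matrix.mul_sub, Matrix.sub_mul, Matrix.mul_smul, Matrix.smul_mul, hTQT]
    rwa [hcalc] at h
  have hrank : P.rank ≤ k :=
    ((rank_mul_le_left _ _).trans (rank_mul_le_right _ _)).trans hk
  have hkey : ε ^ k ≤ (1 - P).det := det_one_sub_ge_pow hP hε hε1 hPle hrank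
  -- determinants: `det T · det Q · det T = 1`, `det T · det(Q − D) · det T = det(1 − P)`
  have hdet1 : T.det * Q.det * T.det = 1 := by rw [← det_mul, ← det_mul, hTQT, det_one]
  have hconj : T * (Q - D) * T = 1 - P := by rw [Matrix.mul_sub, Matrix.sub_mul, hTQT]
  have hdet2 : T.det * (Q - D).det * T.det = (1 - P).det := by rw [← det_mul, ← det_mul, hconj]
  have hQdet : 0 < Q.det := hQ.det_pos
  have hQD : (Q - D).det = (1 - P).det * Q.det := by
    calc (Q - D).det = (Q - D).det * (T.det * Q.det * T.det) := by rw [hdet1, mul_one]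
      _ = T.det * (Q - D).det * T.det * Q.det := by ring
      _ = (1 - P).det * Q.det := by rw [hdet2]
  rw [hQD]
  exact mul_le_mul_of_nonneg_right hkey hQdet.le

end Literature.LinearAlgebra.Matrix

end
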